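import Summits.RiemannHypothesis.RiemannHypothesis.Theorems.IntegerScrewTopBlockPosDefs

/-!
# P-POS kernel certificate, segment file 2/6 — planner sos-theory gen17 (dev; filing by a prover seat)

Each theorem certifies one box `[P0,P1]/DP × [X0,X1]/DX` of the region `φ ∈ [1/32, 21/50]`,
`x ∈ [0, 1/31]` by running the adaptive recursion `certify` of `IntegerScrewTopBlockPosDefs`
INSIDE THE KERNEL (`decide +kernel`); the 48 boxes of the six segment files tile the region
(8 x-strips × 6 dyadic φ-pieces, ≤ 23 cell evaluations per theorem, ≈ 2 s kernel time each).
Soundness (`certify_sound`, `certifyStrip_sound`) and the assembly live in the `…Sound*` / `…Final`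
modules.  Nothing here bears on the truth of RH.
-/

set_option linter.dupNamespace false

namespace Summit.RiemannHypothesis.RiemannHypothesis.Theorems.IntegerScrew.TopBlockPos

set_option maxRecDepth 200000 in
set_option maxHeartbeats 0 in
/-- Kernel: box 8 — `φ ∈ [45504, 65408]/DP`, `x ∈ [16, 32]/DX` (13 cell evaluations). -/
theorem seg8 : certify 40 45504 65408 16 32 = true := by
  decide +kernel

set_option maxRecDepth 200000 in
set_option maxHeartbeats 0 in
/-- Kernel: box 9 — `φ ∈ [65408, 105216]/DP`, `x ∈ [16, 32]/DX` (11 cell evaluations). -/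
theorem seg9 : certify 40 65408 105216 16 32 = true := by
  decide +kernel

set_option maxRecDepth 200000 in
set_option maxHeartbeats 0 in
/-- Kernel: box 10 — `φ ∈ [105216, 184832]/DP`, `x ∈ [16, 32]/DX` (9 cell evaluations). -/
theorem seg10 : certify 40 105216 184832 16 32 = true := by
  decide +kernel

set_option maxRecDepth 200000 in
set_option maxHeartbeats 0 in
/-- Kernel: box 11 — `φ ∈ [184832, 344064]/DP`, `x ∈ [16, 32]/DX` (10 cell evaluations). -/
theorem seg11 : certify 40 184832 344064 16 32 = true := by
  decide +kernel

set_option maxRecDepth 200000 in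
set_option maxHeartbeats 0 in
/-- Kernel: box 12 — `φ ∈ [25600, 35552]/DP`, `x ∈ [32, 48]/DX` (21 cell evaluations). -/
theorem seg12 : certify 40 25600 35552 32 48 = true := by
  decide +kernel

set_option maxRecDepth 200000 in
set_option maxHeartbeats 0 in
/-- Kernel: box 13 — `φ ∈ [35552, 45504]/DP`, `x ∈ [32, 48]/DX` (15 cell evaluations). -/
theorem seg13 : certify 40 35552 45504 32 48 = true := by
  decide +kernel

set_option maxRecDepth 200000 in
set_option maxHeartbeats 0 in
/-- Kernel: box 14 — `φ ∈ [45504, 65408]/DP`, `x ∈ [32, 48]/DX` (13 cell evaluations). -/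
theorem seg14 : certify 40 45504 65408 32 48 = true := by
  decide +kernel

set_option maxRecDepth 200000 in
set_option maxHeartbeats 0 in
/-- Kernel: box 15 — `φ ∈ [65408, 105216]/DP`, `x ∈ [32, 48]/DX` (11 cell evaluations). -/
theorem seg15 : certify 40 65408 105216 32 48 = true := by
  decide +kernel

end Summit.RiemannHypothesis.RiemannHypothesis.Theorems.IntegerScrew.TopBlockPos
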